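import Literature.Analysis.Complex.Hurwitz
import Mathlib.Analysis.SpecialFunctions.Complex.Log
import Mathlib.Analysis.SpecialFunctions.Complex.LogDeriv
import Mathlib.Analysis.SpecialFunctions.Complex.LogBounds
import Mathlib.Analysis.Complex.CauchyIntegral
import HarnessLib

/-!
# The Beraha–Kahane–Weiss two-level zero lemma in a holomorphic parameter, with amplitudes

Analysis/Complex proofs-layer file (theorems only, no definitions, no named facts). Beraha, Kahane
and Weiss (1975/1978) locate the limits of zeros of `P_M(z) = Σ_j α_j(z) λ_j(z)^M` as `M → ∞`:
under their non-degeneracy conditions (no `α_j ≡ 0`, no `λ_j ≡ ω λ_k` with `|ω| = 1`) the limit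
points with TWO dominant terms are exactly the points where `|λ₁| = |λ₂|` are the eigenvalues of
largest modulus ("equimodular curves"; the mechanism behind partition-function zeros of transfer
matrices). We prove the existence half in its local two-level normal form, with holomorphic
AMPLITUDES: if on a disc around `a₀`

  `f_M(a) = c₀(a) + c₁(a) u(a)^M + O(q^M)`,  `0 ≤ q < 1`,

with `u, c₀, c₁, f_M` holomorphic, `‖u(a₀)‖ = 1`, `u` non-constant, `c₀(a₀) ≠ 0 ≠ c₁(a₀)`, then
`f_M` has a zero in the disc for every large `M` (`exists_zero_of_twoLevel`). The amplitude-free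
case `c₀ = c₁ = 1` (the form used for `tr T(a)^M` normalised by the dominant eigenvalue) is the
Summit-side `exists_zero_of_holomorphic_twoLevel`, an instance of the present theorem with constant
amplitudes; the amplitude form is what a transfer-operator expansion
`Z_M(a) = c₀(a)λ₀(a)^M + c₁(a)λ₁(a)^M + O(rᴹ)` (two simple dominant eigenvalues, Kato perturbation
theory, `Literature/Analysis/OperatorTheory/SimpleEigenvalueHolomorphic.lean`) actually delivers,
with `u = λ₁/λ₀` after division by `λ₀^M`.

Proof (M-th root extraction + Hurwitz). On a small ball: `u ≠ u(a₀)` off the centre (identity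
principle), `s < ‖u‖ < 2` with `q < s < 1`, `‖c₀‖ ≥ ‖c₀(a₀)‖/2`, and `κ := c₁/c₀` stays within
`‖κ/κ(a₀) − 1‖ ≤ 1/2`, so `Lκ := log κ(a₀) + log(κ/κ(a₀))` is a bounded holomorphic logarithm of
`κ`. For large `M` the ratio `w := (f_M/c₀ − 1 − κu^M)/(κu^M)` has norm `≤ 1/2`, the root
`V_M := u · exp((Lκ + log(1 + w))/M)` is holomorphic with `f_M = c₀ (1 + V_M^M)` and
`‖V_M − u‖ = O(1/M)`; with `ζ_M` an `M`-th root of `−1` at distance `O(1/M)` from `u(a₀)`, the tree's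
Hurwitz theorem applied to `V_M − ζ_M → u − u(a₀)` gives `a` with `V_M(a) = ζ_M`, i.e. `f_M(a) = 0`.
(Adapted and generalised from the Summit-side
`Theorems/BalabanIRBirComplexStableXYHolomorphicTwoLevelZero.lean`, which is the case `c₀ = c₁ = 1`.)

## Mathlib / tree search

Mathlib: `Complex.norm_log_one_add_half_le_self`, `Complex.norm_exp_sub_one_le`, `Complex.exp_log`,
`Complex.mem_slitPlane_of_norm_lt_one`, `DifferentiableOn.clog/.cexp`, `abs_sub_round`,
`AnalyticAt.eventually_eq_or_eventually_ne` (identity principle); tree: Hurwitz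
(`Complex.eventually_exists_zero_mem_ball_of_tendstoUniformlyOn`). No BKW-type statement in
Literature (searched `Beraha`, `equimodular`, `twoLevel`).

## References

* S. Beraha, J. Kahane, N. J. Weiss, *Limits of zeroes of recursively defined polynomials*,
  Proc. Nat. Acad. Sci. USA 72 (1975) 4209, Theorem (non-degenerate case, existence of limit
  points on equimodular loci). [BerahaKahaneWeiss1975]
-/

noncomputable section

open Complex Metric Set Filter Topology
open scoped Real

namespace Literature.Analysis.Complex

/-! ### Elementary estimates -/

/-- `exp((2k+1)π i) = −1`. [folklore] -/
theorem exp_odd_mul_pi_mul_I (k : ℤ) : exp ((((2 * (k : ℝ) + 1) * π : ℝ) : ℂ) * I) = -1 := by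
  have h : ((((2 * (k : ℝ) + 1) * π : ℝ) : ℂ) * I) = (k : ℂ) * (2 * π * I) + π * I := by
    push_cast
    ring
  rw [h, exp_add, exp_int_mul_two_pi_mul_I, one_mul, exp_pi_mul_I]

/-- `‖exp(iα) − exp(iβ)‖ ≤ 2|α − β|` for `|α − β| ≤ 1`. [folklore] -/
theorem norm_exp_mul_I_sub_exp_mul_I_le {α β : ℝ} (h : |α - β| ≤ 1) :
    ‖exp ((α : ℂ) * I) - exp ((β : ℂ) * I)‖ ≤ 2 * |α - β| := by
  have hfac : exp ((α : ℂ) * I) - exp ((β : ℂ) * I) =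
      exp ((β : ℂ) * I) * (exp ((((α - β : ℝ)) : ℂ) * I) - 1) := by
    rw [mul_sub, mul_one, ← exp_add]
    congr 1
    push_cast
    ring_nf
  have hn : ‖(((α - β : ℝ)) : ℂ) * I‖ = |α - β| := by
    rw [norm_mul, norm_I, mul_one, norm_real, Real.norm_eq_abs]
  rw [hfac, norm_mul, norm_exp_ofReal_mul_I, one_mul]
  calc ‖exp ((((α - β : ℝ)) : ℂ) * I) - 1‖ ≤ 2 * ‖(((α - β : ℝ)) : ℂ) * I‖ :=
        norm_exp_sub_one_le (by rw [hn]; exact h)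
    _ = 2 * |α - β| := by rw [hn]

/-- **An `M`-th root of `−1` within `2π/M` of a given point of the unit circle**: for `M ≥ 1` with
`π/M ≤ 1` and `θ₀ ∈ ℝ` there is `ζ` with `ζ^M = −1` and `‖ζ − exp(iθ₀)‖ ≤ 2π/M`
(`ζ = exp((2k+1)πi/M)` with `k = round((Mθ₀/π − 1)/2)`). [folklore] -/
theorem exists_pow_eq_neg_one_norm_sub_le {M : ℕ} (hM : 1 ≤ M) (hMπ : π / M ≤ 1) (θ₀ : ℝ) :
    ∃ ζ : ℂ, ζ ^ M = -1 ∧ ‖ζ - exp ((θ₀ : ℂ) * I)‖ ≤ 2 * (π / M) := by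
  have hMpos : (0 : ℝ) < M := by exact_mod_cast hM
  have hM0 : (M : ℂ) ≠ 0 := Nat.cast_ne_zero.mpr (by omega)
  set k : ℤ := round (((M : ℝ) * θ₀ / π - 1) / 2) with hk
  set α : ℝ := (2 * (k : ℝ) + 1) * π / M with hα
  refine ⟨exp ((α : ℂ) * I), ?_, ?_⟩
  · rw [← exp_nat_mul, ← exp_odd_mul_pi_mul_I k]
    congr 1
    rw [hα]
    push_cast
    field_simp
  · -- `|α − θ₀| ≤ π/M`
    have hround : |((M : ℝ) * θ₀ / π - 1) / 2 - k| ≤ 1 / 2 := by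
      rw [hk]; exact abs_sub_round _
    have hdiff : |α - θ₀| ≤ π / M := by
      have hπ : 0 < π := Real.pi_pos
      have key : α - θ₀ = -(2 * π / M) * ((((M : ℝ) * θ₀ / π - 1) / 2 - k)) := by
        rw [hα]
        field_simp
        ring
      rw [key, abs_mul, abs_neg, abs_of_pos (by positivity)]
      calc 2 * π / M * |((M : ℝ) * θ₀ / π - 1) / 2 - k| ≤ 2 * π / M * (1 / 2) := by gcongr
        _ = π / M := by ring
    calc ‖exp ((α : ℂ) * I) - exp ((θ₀ : ℂ) * I)‖ ≤ 2 * |α - θ₀| :=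
          norm_exp_mul_I_sub_exp_mul_I_le (hdiff.trans hMπ)
      _ ≤ 2 * (π / M) := by gcongr

/-- Root extraction with an amplitude: for `x ≠ 0`, `M ≠ 0`, `exp ℓ = κ` and `‖w‖ ≤ 1/2`,
`(x · exp((ℓ + log(1 + w))/M))^M = κ x^M (1 + w)`. [folklore] -/
theorem root_pow_eq {M : ℕ} (hM : M ≠ 0) {x κ ℓ w : ℂ} (hℓ : exp ℓ = κ) (hw : ‖w‖ ≤ 1 / 2) :
    (x * exp ((ℓ + log (1 + w)) / (M : ℂ))) ^ M = κ * x ^ M * (1 + w) := by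
  have hM0 : (M : ℂ) ≠ 0 := Nat.cast_ne_zero.mpr hM
  have hslit : 1 + w ∈ slitPlane := mem_slitPlane_of_norm_lt_one (by linarith)
  rw [mul_pow, ← exp_nat_mul, mul_div_cancel₀ _ hM0, exp_add, hℓ, exp_log (slitPlane_ne_zero hslit)]
  ring

/-- The extracted root is `O(1/M)`-close to `x`: if `‖ℓ‖ ≤ Λ`, `‖w‖ ≤ 1/2`, `1 ≤ M` and
`(Λ + 1)/M ≤ 1` then `‖x · exp((ℓ + log(1+w))/M) − x‖ ≤ ‖x‖ · 2(Λ + 1)/M`. [folklore] -/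
theorem norm_root_sub_le {M : ℕ} (hM : 1 ≤ M) {x ℓ w : ℂ} {Λ : ℝ} (hℓ : ‖ℓ‖ ≤ Λ)
    (hw : ‖w‖ ≤ 1 / 2) (hΛM : (Λ + 1) / M ≤ 1) :
    ‖x * exp ((ℓ + log (1 + w)) / (M : ℂ)) - x‖ ≤ ‖x‖ * (2 * ((Λ + 1) / M)) := by
  have hMpos : (0 : ℝ) < M := by exact_mod_cast hM
  have hL : ‖log (1 + w)‖ ≤ 1 := by
    have h := norm_log_one_add_half_le_self hw
    linarith [norm_nonneg w]
  have hz : ‖(ℓ + log (1 + w)) / (M : ℂ)‖ ≤ (Λ + 1) / M := by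
    rw [norm_div, norm_natCast]
    exact div_le_div_of_nonneg_right ((norm_add_le _ _).trans (add_le_add hℓ hL)) hMpos.le
  rw [← mul_sub_one, norm_mul]
  gcongr
  calc ‖exp ((ℓ + log (1 + w)) / (M : ℂ)) - 1‖ ≤ 2 * ‖(ℓ + log (1 + w)) / (M : ℂ)‖ :=
        norm_exp_sub_one_le (hz.trans hΛM)
    _ ≤ 2 * ((Λ + 1) / M) := by gcongr

/-! ### The two-level zero lemma with amplitudes -/

/-- **Beraha–Kahane–Weiss two-level zero lemma (holomorphic parameter, with amplitudes).**
Let `u, c₀, c₁` be holomorphic on `ball a₀ ρ` with `‖u a₀‖ = 1`, `u` non-constant,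
`c₀ a₀ ≠ 0`, `c₁ a₀ ≠ 0`, and let the holomorphic `f M` satisfy
`‖f M − c₀ − c₁ · u^M‖ ≤ C q^M` on the ball for all large `M`, where `0 ≤ q < 1`. Then `f M` has
a zero in `ball a₀ ρ` for every large `M` (the two-dominant-terms, non-degenerate case of the
Beraha–Kahane–Weiss theorem: zeros accumulate at every point of the equimodular locus
`|λ₀| = |λ₁|`, here `‖u a₀‖ = 1` with `u = λ₁/λ₀`). [cite: BerahaKahaneWeiss1975, Theorem (non-degenerate two-term case)] -/
theorem exists_zero_of_twoLevel (u c₀ c₁ : ℂ → ℂ) (f : ℕ → ℂ → ℂ) (a₀ : ℂ) {ρ C q : ℝ}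
    (hρ : 0 < ρ) (hq0 : 0 ≤ q) (hq1 : q < 1) (hu : DifferentiableOn ℂ u (ball a₀ ρ))
    (hnorm : ‖u a₀‖ = 1) (hnc : ∃ a ∈ ball a₀ ρ, u a ≠ u a₀)
    (hc₀ : DifferentiableOn ℂ c₀ (ball a₀ ρ)) (hc₁ : DifferentiableOn ℂ c₁ (ball a₀ ρ))
    (hc₀0 : c₀ a₀ ≠ 0) (hc₁0 : c₁ a₀ ≠ 0)
    (hf : ∀ M : ℕ, DifferentiableOn ℂ (f M) (ball a₀ ρ))
    (happrox : ∃ M₁ : ℕ, ∀ M : ℕ, M₁ ≤ M → ∀ a ∈ ball a₀ ρ,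
      ‖f M a - c₀ a - c₁ a * (u a) ^ M‖ ≤ C * q ^ M) :
    ∃ M₀ : ℕ, ∀ M : ℕ, M₀ ≤ M → ∃ a ∈ ball a₀ ρ, f M a = 0 := by
  obtain ⟨M₁, hM₁⟩ := happrox
  -- the amplitude ratio `κ = c₁/c₀` and a logarithm of `κ a₀`
  set κ : ℂ → ℂ := fun a => c₁ a / c₀ a with hκ
  have hκ0 : κ a₀ ≠ 0 := div_ne_zero hc₁0 hc₀0
  set ℓ₀ : ℂ := log (κ a₀) with hℓ₀
  have hℓ₀exp : exp ℓ₀ = κ a₀ := exp_log hκ0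
  -- Step 1: a good radius `r₁` (and `r := r₁ / 2`)
  obtain ⟨s, hqs, hs1⟩ : ∃ s : ℝ, q < s ∧ s < 1 := ⟨(1 + q) / 2, by linarith, by linarith⟩
  have hs0 : 0 < s := lt_of_le_of_lt hq0 hqs
  have ha₀ : a₀ ∈ ball a₀ ρ := mem_ball_self hρ
  have hballnhds : ball a₀ ρ ∈ 𝓝 a₀ := isOpen_ball.mem_nhds ha₀
  have han : AnalyticOnNhd ℂ u (ball a₀ ρ) := hu.analyticOnNhd isOpen_ball
  have hcont : ContinuousAt u a₀ := (han a₀ ha₀).continuousAt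
  have hiso : ∀ᶠ a in 𝓝[≠] a₀, u a ≠ u a₀ := by
    rcases (han a₀ ha₀).eventually_eq_or_eventually_ne analyticAt_const with h | h
    · exfalso
      obtain ⟨a, ha, hne⟩ := hnc
      exact hne (han.eqOn_of_preconnected_of_eventuallyEq analyticOnNhd_const
        (convex_ball a₀ ρ).isPreconnected ha₀ h ha)
    · exact h
  have hgt : ∀ᶠ a in 𝓝 a₀, s < ‖u a‖ :=
    Filter.Tendsto.eventually_const_lt (show s < ‖u a₀‖ by rw [hnorm]; exact hs1) hcont.norm
  have hlt : ∀ᶠ a in 𝓝 a₀, ‖u a‖ < 2 :=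
    Filter.Tendsto.eventually_lt_const (show ‖u a₀‖ < 2 by rw [hnorm]; norm_num) hcont.norm
  -- control of the amplitudes near `a₀`
  have hc₀cont : ContinuousAt c₀ a₀ := (hc₀.differentiableAt hballnhds).continuousAt
  have hc₀gt : ∀ᶠ a in 𝓝 a₀, ‖c₀ a₀‖ / 2 < ‖c₀ a‖ :=
    Filter.Tendsto.eventually_const_lt (by linarith [norm_pos_iff.2 hc₀0]) hc₀cont.norm
  have hκcont : ContinuousAt κ a₀ :=
    ((hc₁.differentiableAt hballnhds).continuousAt).div hc₀cont hc₀0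
  have hκclose : ∀ᶠ a in 𝓝 a₀, ‖κ a / κ a₀ - 1‖ < 1 / 2 := by
    have h : ContinuousAt (fun a => κ a / κ a₀ - 1) a₀ := (hκcont.div_const _).sub continuousAt_const
    have h0 : (fun a => κ a / κ a₀ - 1) a₀ = 0 := by simp [div_self hκ0]
    have := h.eventually (Metric.ball_mem_nhds _ (show (0:ℝ) < 1 / 2 by norm_num))
    filter_upwards [this] with a ha
    rw [div_self hκ0, sub_self, dist_zero_right] at ha
    exact ha
  have hall : ∀ᶠ a in 𝓝 a₀, (a ≠ a₀ → u a ≠ u a₀) ∧ a ∈ ball a₀ ρ ∧ s < ‖u a‖ ∧ ‖u a‖ < 2 ∧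
      ‖c₀ a₀‖ / 2 < ‖c₀ a‖ ∧ ‖κ a / κ a₀ - 1‖ < 1 / 2 :=
    (eventually_nhdsWithin_iff.1 hiso).and ((eventually_of_mem hballnhds fun _ h => h).and
      (hgt.and (hlt.and (hc₀gt.and hκclose))))
  obtain ⟨r₁, hr₁, hB⟩ := Metric.eventually_nhds_iff_ball.1 hall
  obtain ⟨r, hr, hrr₁⟩ : ∃ r : ℝ, 0 < r ∧ r < r₁ := ⟨r₁ / 2, by positivity, by linarith⟩
  have hsub : closedBall a₀ r ⊆ ball a₀ r₁ := closedBall_subset_ball hrr₁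
  have hBρ : ball a₀ r₁ ⊆ ball a₀ ρ := fun a ha => (hB a ha).2.1
  have hu0 : ∀ a ∈ ball a₀ r₁, u a ≠ 0 := fun a ha h0 => by
    have h := (hB a ha).2.2.1
    rw [h0, norm_zero] at h
    linarith
  have hc₀pos : 0 < ‖c₀ a₀‖ / 2 := by linarith [norm_pos_iff.2 hc₀0]
  have hc₀ne : ∀ a ∈ ball a₀ r₁, c₀ a ≠ 0 := fun a ha h0 => by
    have h := (hB a ha).2.2.2.2.1
    rw [h0, norm_zero] at h
    linarith
  -- the holomorphic logarithm `Lκ` of `κ` on `ball a₀ r₁`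
  set Lκ : ℂ → ℂ := fun a => ℓ₀ + log (1 + (κ a / κ a₀ - 1)) with hLκ
  have hLκexp : ∀ a ∈ ball a₀ r₁, exp (Lκ a) = κ a := by
    intro a ha
    have hsl : 1 + (κ a / κ a₀ - 1) ∈ slitPlane :=
      mem_slitPlane_of_norm_lt_one (by linarith [(hB a ha).2.2.2.2.2])
    simp only [hLκ]
    rw [exp_add, hℓ₀exp, exp_log (slitPlane_ne_zero hsl), add_sub_cancel, mul_div_cancel₀ _ hκ0]
  have hLκnorm : ∀ a ∈ ball a₀ r₁, ‖Lκ a‖ ≤ ‖ℓ₀‖ + 1 := by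
    intro a ha
    have hsm : ‖κ a / κ a₀ - 1‖ ≤ 1 / 2 := (hB a ha).2.2.2.2.2.le
    have hlog : ‖log (1 + (κ a / κ a₀ - 1))‖ ≤ 1 := by
      have h := norm_log_one_add_half_le_self hsm
      linarith [norm_nonneg (κ a / κ a₀ - 1)]
    exact (norm_add_le _ _).trans (add_le_add le_rfl hlog)
  have hκdiff : DifferentiableOn ℂ κ (ball a₀ r₁) :=
    (hc₁.mono hBρ).div (hc₀.mono hBρ) hc₀ne
  have hLκdiff : DifferentiableOn ℂ Lκ (ball a₀ r₁) := by
    refine (differentiableOn_const _).add (((hκdiff.div_const _).sub_const 1).const_add 1 |>.clog ?_)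
    intro a ha
    exact mem_slitPlane_of_norm_lt_one (by linarith [(hB a ha).2.2.2.2.2])
  have hκlow : ∀ a ∈ ball a₀ r₁, ‖κ a₀‖ / 2 ≤ ‖κ a‖ := by
    intro a ha
    have hsm : ‖κ a / κ a₀ - 1‖ ≤ 1 / 2 := (hB a ha).2.2.2.2.2.le
    have h1 : ‖κ a - κ a₀‖ ≤ ‖κ a₀‖ / 2 := by
      have : κ a - κ a₀ = κ a₀ * (κ a / κ a₀ - 1) := by field_simp
      rw [this, norm_mul]
      calc ‖κ a₀‖ * ‖κ a / κ a₀ - 1‖ ≤ ‖κ a₀‖ * (1 / 2) := by gcongr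
        _ = ‖κ a₀‖ / 2 := by ring
    calc ‖κ a₀‖ / 2 = ‖κ a₀‖ - ‖κ a₀‖ / 2 := by ring
      _ ≤ ‖κ a₀‖ - ‖κ a - κ a₀‖ := by linarith
      _ ≤ ‖κ a‖ := by
          have := norm_sub_norm_le (κ a₀) (κ a₀ - κ a)
          rw [sub_sub_cancel, norm_sub_rev] at this
          linarith
  have hκpos : 0 < ‖κ a₀‖ / 2 := by linarith [norm_pos_iff.2 hκ0]
  -- Step 2: large `M`
  set C₁ : ℝ := C / (‖c₀ a₀‖ / 2) / (‖κ a₀‖ / 2) with hC₁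
  have hqs1 : q / s < 1 := (div_lt_one hs0).2 hqs
  have hqs0 : 0 ≤ q / s := div_nonneg hq0 hs0.le
  have htend : Tendsto (fun M : ℕ => C₁ * (q / s) ^ M) atTop (𝓝 0) := by
    have h := (tendsto_pow_atTop_nhds_zero_of_lt_one hqs0 hqs1).const_mul C₁
    rwa [mul_zero] at h
  have hev₁ : ∀ᶠ M : ℕ in atTop, C₁ * (q / s) ^ M ≤ 1 / 2 :=
    Filter.Tendsto.eventually_le_const (show (0 : ℝ) < 1 / 2 by norm_num) htend
  set Λ : ℝ := ‖ℓ₀‖ + 1 with hΛ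
  have hev₂ : ∀ᶠ M : ℕ in atTop, (Λ + 1) / (M : ℝ) ≤ 1 :=
    Filter.Tendsto.eventually_le_const one_pos (tendsto_const_div_atTop_nhds_zero_nat (Λ + 1))
  have hev₃ : ∀ᶠ M : ℕ in atTop, π / (M : ℝ) ≤ 1 :=
    Filter.Tendsto.eventually_le_const one_pos (tendsto_const_div_atTop_nhds_zero_nat π)
  obtain ⟨M₂, hM₂⟩ := Filter.eventually_atTop.1
    ((eventually_ge_atTop M₁).and ((eventually_ge_atTop 1).and (hev₁.and (hev₂.and hev₃))))
  -- the remainder ratio `w` is small on `ball a₀ r₁`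
  set w : ℕ → ℂ → ℂ := fun M a => (f M a / c₀ a - 1 - κ a * (u a) ^ M) / (κ a * (u a) ^ M)
    with hw_def
  have hw : ∀ M, M₂ ≤ M → ∀ a ∈ ball a₀ r₁, ‖w M a‖ ≤ 1 / 2 := by
    intro M hM a ha
    obtain ⟨hMM₁, -, hC, -, -⟩ := hM₂ M hM
    have hsa : s < ‖u a‖ := (hB a ha).2.2.1
    have huM : 0 < ‖u a‖ ^ M := pow_pos (hs0.trans hsa) M
    have hκa : 0 < ‖κ a‖ := hκpos.trans_le (hκlow a ha)
    have hc₀a : ‖c₀ a₀‖ / 2 < ‖c₀ a‖ := (hB a ha).2.2.2.2.1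
    -- the numerator is `(f − c₀ − c₁ u^M)/c₀`
    have hnum : f M a / c₀ a - 1 - κ a * (u a) ^ M = (f M a - c₀ a - c₁ a * (u a) ^ M) / c₀ a := by
      simp only [hκ]
      field_simp [hc₀ne a ha]
    have hnum_le : ‖f M a / c₀ a - 1 - κ a * (u a) ^ M‖ ≤ C / (‖c₀ a₀‖ / 2) * q ^ M := by
      rw [hnum, norm_div]
      calc ‖f M a - c₀ a - c₁ a * (u a) ^ M‖ / ‖c₀ a‖ ≤ (C * q ^ M) / (‖c₀ a₀‖ / 2) := by
            have hCq : ‖f M a - c₀ a - c₁ a * (u a) ^ M‖ ≤ C * q ^ M := hM₁ M hMM₁ a (hBρ ha)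
            have hCq0 : 0 ≤ C * q ^ M := (norm_nonneg _).trans hCq
            calc ‖f M a - c₀ a - c₁ a * (u a) ^ M‖ / ‖c₀ a‖ ≤ (C * q ^ M) / ‖c₀ a‖ :=
                  div_le_div_of_nonneg_right hCq (norm_nonneg _)
              _ ≤ (C * q ^ M) / (‖c₀ a₀‖ / 2) :=
                  div_le_div_of_nonneg_left hCq0 hc₀pos hc₀a.le
        _ = C / (‖c₀ a₀‖ / 2) * q ^ M := by ring
    simp only [hw_def]
    rw [norm_div, norm_mul, norm_pow, div_le_iff₀ (mul_pos hκa huM)]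
    calc ‖f M a / c₀ a - 1 - κ a * u a ^ M‖ ≤ C / (‖c₀ a₀‖ / 2) * q ^ M := hnum_le
      _ = C₁ * (q / s) ^ M * ((‖κ a₀‖ / 2) * s ^ M) := by
          simp only [hC₁]
          rw [div_pow]
          field_simp
      _ ≤ 1 / 2 * ((‖κ a₀‖ / 2) * s ^ M) :=
          mul_le_mul_of_nonneg_right hC (mul_nonneg hκpos.le (pow_nonneg hs0.le M))
      _ ≤ 1 / 2 * (‖κ a‖ * ‖u a‖ ^ M) := by
          gcongr
          · exact hκlow a ha
  -- the extracted root `V M`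
  set V : ℕ → ℂ → ℂ := fun M a => u a * exp ((Lκ a + log (1 + w M a)) / (M : ℂ)) with hV
  have hVf : ∀ M, M₂ ≤ M → ∀ a ∈ ball a₀ r₁, f M a = c₀ a * (1 + (V M a) ^ M) := by
    intro M hM a ha
    obtain ⟨-, hM1, -, -, -⟩ := hM₂ M hM
    have hroot := root_pow_eq (M := M) (x := u a) (by omega) (hLκexp a ha) (hw M hM a ha)
    have hκu : κ a * (u a) ^ M ≠ 0 :=
      mul_ne_zero (fun h => by have := hκlow a ha; rw [h, norm_zero] at this; linarith)
        (pow_ne_zero _ (hu0 a ha))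
    have h1 : κ a * (u a) ^ M * (1 + w M a) = f M a / c₀ a - 1 := by
      simp only [hw_def]
      rw [mul_add, mul_one, mul_div_cancel₀ _ hκu]
      ring
    simp only [hV]
    rw [hroot, h1, add_sub_cancel]
    field_simp [hc₀ne a ha]
  have hVsub : ∀ M, M₂ ≤ M → ∀ a ∈ ball a₀ r₁, ‖V M a - u a‖ ≤ 4 * ((Λ + 1) / M) := by
    intro M hM a ha
    obtain ⟨-, hM1, -, hΛM, -⟩ := hM₂ M hM
    simp only [hV]
    calc ‖u a * exp ((Lκ a + log (1 + w M a)) / (M : ℂ)) - u a‖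
          ≤ ‖u a‖ * (2 * ((Λ + 1) / M)) := norm_root_sub_le hM1 (hLκnorm a ha) (hw M hM a ha) hΛM
      _ ≤ 2 * (2 * ((Λ + 1) / M)) :=
          mul_le_mul_of_nonneg_right (hB a ha).2.2.2.1.le (by positivity)
      _ = 4 * ((Λ + 1) / M) := by ring
  have hVdiff : ∀ M, M₂ ≤ M → DifferentiableOn ℂ (V M) (ball a₀ r₁) := by
    intro M hM
    have huM : DifferentiableOn ℂ (fun a => κ a * (u a) ^ M) (ball a₀ r₁) :=
      hκdiff.mul ((hu.mono hBρ).pow M)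
    have hκu0 : ∀ a ∈ ball a₀ r₁, κ a * (u a) ^ M ≠ 0 := fun a ha =>
      mul_ne_zero (fun h => by have := hκlow a ha; rw [h, norm_zero] at this; linarith)
        (pow_ne_zero _ (hu0 a ha))
    have hwd : DifferentiableOn ℂ (w M) (ball a₀ r₁) := by
      simp only [hw_def]
      exact (((((hf M).mono hBρ).div (hc₀.mono hBρ) hc₀ne).sub_const 1).sub huM).div huM hκu0
    have hslit : ∀ a ∈ ball a₀ r₁, 1 + w M a ∈ slitPlane := fun a ha =>
      mem_slitPlane_of_norm_lt_one (by linarith [hw M hM a ha])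
    simp only [hV]
    exact (hu.mono hBρ).mul (((hLκdiff.add ((hwd.const_add 1).clog hslit)).div_const _).cexp)
  -- Step 3: the moving targets `ζ M`, `M`-th roots of `-1` close to `u a₀ = exp (i θ₀)`
  obtain ⟨θ₀, hθ₀⟩ : ∃ θ₀ : ℝ, exp ((θ₀ : ℂ) * I) = u a₀ :=
    ⟨arg (u a₀), by
      have h := norm_mul_exp_arg_mul_I (u a₀)
      rwa [hnorm, ofReal_one, one_mul] at h⟩
  have hζex : ∀ M, M₂ ≤ M → ∃ ζ : ℂ, ζ ^ M = -1 ∧ ‖ζ - u a₀‖ ≤ 2 * (π / M) := by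
    intro M hM
    obtain ⟨-, hM1, -, -, hMπ⟩ := hM₂ M hM
    obtain ⟨ζ, hζ, hζs⟩ := exists_pow_eq_neg_one_norm_sub_le hM1 hMπ θ₀
    exact ⟨ζ, hζ, by rwa [hθ₀] at hζs⟩
  classical
  set ζ : ℕ → ℂ := fun M => if h : M₂ ≤ M then Classical.choose (hζex M h) else 0 with hζdef
  have hζpow : ∀ M, M₂ ≤ M → (ζ M) ^ M = -1 := fun M hM => by
    simp only [hζdef, dif_pos hM]; exact (Classical.choose_spec (hζex M hM)).1
  have hζsub : ∀ M, M₂ ≤ M → ‖ζ M - u a₀‖ ≤ 2 * (π / M) := fun M hM => by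
    simp only [hζdef, dif_pos hM]; exact (Classical.choose_spec (hζex M hM)).2
  -- Step 4: Hurwitz's theorem for `V M - ζ M → u - u a₀` on `closedBall a₀ r`
  have hFdiff : ∀ᶠ M in atTop, DiffContOnCl ℂ (fun a => V M a - ζ M) (ball a₀ r) := by
    filter_upwards [eventually_ge_atTop M₂] with M hM
    exact ((hVdiff M hM).sub_const (ζ M)).diffContOnCl_ball hsub
  have hunif : TendstoUniformlyOn (fun M a => V M a - ζ M) (fun a => u a - u a₀) atTop
      (closedBall a₀ r) := by
    refine Metric.tendstoUniformlyOn_iff.2 fun ε hε => ?_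
    have hεev : ∀ᶠ M : ℕ in atTop, (2 * π + 4 * (Λ + 1)) / (M : ℝ) < ε :=
      Filter.Tendsto.eventually_lt_const hε
        (tendsto_const_div_atTop_nhds_zero_nat (2 * π + 4 * (Λ + 1)))
    filter_upwards [eventually_ge_atTop M₂, hεev] with M hM hMε a ha
    obtain ⟨-, hM1, -, -, -⟩ := hM₂ M hM
    have hMpos : (0 : ℝ) < M := by exact_mod_cast hM1
    have ha₁ : a ∈ ball a₀ r₁ := hsub ha
    rw [dist_eq_norm]
    calc ‖u a - u a₀ - (V M a - ζ M)‖ = ‖ζ M - u a₀ - (V M a - u a)‖ := by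
          congr 1
          ring
      _ ≤ ‖ζ M - u a₀‖ + ‖V M a - u a‖ := norm_sub_le _ _
      _ ≤ 2 * (π / M) + 4 * ((Λ + 1) / M) := add_le_add (hζsub M hM) (hVsub M hM a ha₁)
      _ = (2 * π + 4 * (Λ + 1)) / M := by
          field_simp
      _ < ε := hMε
  have hgcont : ContinuousOn (fun a => u a - u a₀) (sphere a₀ r) :=
    (hu.continuousOn.mono (sphere_subset_closedBall.trans (hsub.trans hBρ))).sub
      continuousOn_const
  have hgs : ∀ a ∈ sphere a₀ r, u a - u a₀ ≠ 0 := by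
    intro a ha
    have hne : a ≠ a₀ := by
      rintro rfl
      simp only [mem_sphere, dist_self] at ha
      exact hr.ne ha
    exact sub_ne_zero.2 ((hB a (hsub (sphere_subset_closedBall ha))).1 hne)
  have hzero := _root_.Complex.eventually_exists_zero_mem_ball_of_tendstoUniformlyOn hr hFdiff
    hunif hgcont (sub_self (u a₀)) hgs
  -- Step 5: conclusion
  obtain ⟨M₀, hM₀⟩ := Filter.eventually_atTop.1 (hzero.and (eventually_ge_atTop M₂))
  refine ⟨M₀, fun M hM => ?_⟩
  obtain ⟨⟨a, ha, hFa⟩, hMM₂⟩ := hM₀ M hM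
  have ha₁ : a ∈ ball a₀ r₁ := hsub (ball_subset_closedBall ha)
  refine ⟨a, hBρ ha₁, ?_⟩
  have hVa : V M a = ζ M := sub_eq_zero.1 hFa
  rw [hVf M hMM₂ a ha₁, hVa, hζpow M hMM₂, add_neg_cancel, mul_zero]

/-- **Two dominant eigenvalues form.** If `Z M = c₀ λ₀^M + c₁ λ₁^M + R M` on the ball with
`λ₀, λ₁, c₀, c₁, Z M` holomorphic, `λ₀ ≠ 0`, `‖λ₁ a₀‖ = ‖λ₀ a₀‖` (a modulus tie), `λ₁/λ₀`
non-constant, `c₀ a₀ ≠ 0 ≠ c₁ a₀` and `‖R M‖ ≤ C (q‖λ₀‖)^M`-type bound `‖R M a‖ ≤ C q^M ‖λ₀ a‖^M`,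
then `Z M` vanishes somewhere in the ball for every large `M`. [cite: BerahaKahaneWeiss1975, Theorem (non-degenerate two-term case)] -/
theorem exists_zero_of_two_dominant_eigenvalues (lam₀ lam₁ c₀ c₁ : ℂ → ℂ) (Z : ℕ → ℂ → ℂ)
    (a₀ : ℂ) {ρ C q : ℝ} (hρ : 0 < ρ) (hq0 : 0 ≤ q) (hq1 : q < 1)
    (h₀ : DifferentiableOn ℂ lam₀ (ball a₀ ρ)) (h₁ : DifferentiableOn ℂ lam₁ (ball a₀ ρ))
    (hlam0 : ∀ a ∈ ball a₀ ρ, lam₀ a ≠ 0) (htie : ‖lam₁ a₀‖ = ‖lam₀ a₀‖)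
    (hnc : ∃ a ∈ ball a₀ ρ, lam₁ a / lam₀ a ≠ lam₁ a₀ / lam₀ a₀)
    (hc₀ : DifferentiableOn ℂ c₀ (ball a₀ ρ)) (hc₁ : DifferentiableOn ℂ c₁ (ball a₀ ρ))
    (hc₀0 : c₀ a₀ ≠ 0) (hc₁0 : c₁ a₀ ≠ 0)
    (hZ : ∀ M : ℕ, DifferentiableOn ℂ (Z M) (ball a₀ ρ))
    (happrox : ∃ M₁ : ℕ, ∀ M : ℕ, M₁ ≤ M → ∀ a ∈ ball a₀ ρ,
      ‖Z M a - c₀ a * (lam₀ a) ^ M - c₁ a * (lam₁ a) ^ M‖ ≤ C * q ^ M * ‖lam₀ a‖ ^ M) :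
    ∃ M₀ : ℕ, ∀ M : ℕ, M₀ ≤ M → ∃ a ∈ ball a₀ ρ, Z M a = 0 := by
  -- normalise by `λ₀^M`
  set u : ℂ → ℂ := fun a => lam₁ a / lam₀ a with hu_def
  set f : ℕ → ℂ → ℂ := fun M a => Z M a / (lam₀ a) ^ M with hf_def
  have hu : DifferentiableOn ℂ u (ball a₀ ρ) := h₁.div h₀ hlam0
  have hnorm : ‖u a₀‖ = 1 := by
    simp only [hu_def]
    rw [norm_div, htie, div_self (norm_ne_zero_iff.2 (hlam0 a₀ (mem_ball_self hρ)))]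
  have hf : ∀ M, DifferentiableOn ℂ (f M) (ball a₀ ρ) := fun M =>
    (hZ M).div (h₀.pow M) fun a ha => pow_ne_zero _ (hlam0 a ha)
  have happrox' : ∃ M₁ : ℕ, ∀ M : ℕ, M₁ ≤ M → ∀ a ∈ ball a₀ ρ,
      ‖f M a - c₀ a - c₁ a * (u a) ^ M‖ ≤ C * q ^ M := by
    obtain ⟨M₁, h⟩ := happrox
    refine ⟨M₁, fun M hM a ha => ?_⟩
    have hl : (lam₀ a) ^ M ≠ 0 := pow_ne_zero _ (hlam0 a ha)
    have hlpos : 0 < ‖lam₀ a‖ ^ M := pow_pos (norm_pos_iff.2 (hlam0 a ha)) M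
    have key : f M a - c₀ a - c₁ a * (u a) ^ M =
        (Z M a - c₀ a * (lam₀ a) ^ M - c₁ a * (lam₁ a) ^ M) / (lam₀ a) ^ M := by
      simp only [hf_def, hu_def]
      rw [div_pow]
      field_simp
    rw [key, norm_div, norm_pow, div_le_iff₀ hlpos]
    exact h M hM a ha
  obtain ⟨M₀, hM₀⟩ := exists_zero_of_twoLevel u c₀ c₁ f a₀ hρ hq0 hq1 hu hnorm hnc hc₀ hc₁
    hc₀0 hc₁0 hf happrox'
  refine ⟨M₀, fun M hM => ?_⟩
  obtain ⟨a, ha, hfa⟩ := hM₀ M hM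
  refine ⟨a, ha, ?_⟩
  have hl : (lam₀ a) ^ M ≠ 0 := pow_ne_zero _ (hlam0 a ha)
  simp only [hf_def] at hfa
  exact (div_eq_zero_iff.1 hfa).resolve_right hl

end Literature.Analysis.Complex
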